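import Summits.QuantumAdvantage.QuantumAdvantage.Theorems.SosSandwichQuerySecondLevelInfluence
import HarnessLib

/-!
# `Q_T`: the two-chain bound one below the top — general target size (infrastructure for lower Walsh levels)

Support theorem for route `SosSandwich`, crux `PseudoBoundedAA` (stmt-QuantumAdvantage-15237).  The two-chain contraction
argument of `SosSandwichQuerySecondLevelWeight` (`sum_norm_sq_gam_second_finalState_le`, target size `T₂ = 2T−1`) is
re-run for an ARBITRARY target size `T₂ ≥ T`:

* `sum_norm_sq_accVfc_le'` — `Σ_{R ∈ F} ‖Π v_R‖² ≤ 1` for any family `F` of sets (Parseval);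
* **`sum_norm_sq_gam_second_le`** — `Σ_{|R| = T₂−T+1} ‖gam c T₂ ψ R‖² ≤ 4` (`T ≥ 2`, per-index weight bound);
* `norm_pairing_second_le_two'` — `|Σ_{|R| = T₂−T+1} ⟨Π v_R, Γ(R)⟩| ≤ 2`.

Use (recorded for the successor hand, see the item's evidence `Q_T-RUNGS-15237-v2.md`): at Walsh level `2T − 2` the
pairs of two second-level vectors `(T−1, T−1)` are bounded by the case `T₂ = 2T − 2`; the remaining pairs (top × level
`T−2`, and top × top overlapping in one index) need the phantom-index functionals described there.  All proved.

Sources: EscuderoGutierrez2023 (arXiv:2304.06713) §4.2, Remark 4.3; BealsEtAl2001 Lemma 4.1.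
-/

noncomputable section

set_option linter.dupNamespace false

namespace Summit.QuantumAdvantage.QuantumAdvantage.Theorems.SosSandwich.QueryTopLevel

open Matrix Finset Literature.Computability.Cryptography Literature.Computability.QuantumComplexity
open Literature.Computability.Complexity.LowDegree Literature.Probability.RandomGraphs.LowDegree
open Summit.QuantumAdvantage.QuantumAdvantage.Theorems.SosSandwich.QueryFourier
open scoped symmDiff

variable {N : ℕ}

/-- The accept-projected vectors of ANY family of distinct sets have total squared norm at most `1` (Parseval).
[cite: BealsEtAl2001, §2] -/
theorem sum_norm_sq_accVfc_le' (A : QQueryAlg N) (F : Finset (Finset (Fin N))) :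
    ∑ R ∈ F, ∑ s, ‖accVfc A R s‖ ^ 2 ≤ 1 := by
  calc ∑ R ∈ F, ∑ s, ‖accVfc A R s‖ ^ 2
      ≤ ∑ R ∈ F, ∑ s, ‖vfc (fun x => A.finalState x) R s‖ ^ 2 := by
        refine Finset.sum_le_sum fun R _ => Finset.sum_le_sum fun s _ => ?_
        unfold accVfc
        split_ifs <;> simp
    _ ≤ ∑ R, ∑ s, ‖vfc (fun x => A.finalState x) R s‖ ^ 2 :=
        Finset.sum_le_sum_of_subset_of_nonneg (Finset.subset_univ F) fun R _ _ =>
          Finset.sum_nonneg fun s _ => by positivity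
    _ = 1 := sum_vfc_finalState_norm_sq A

/-- **The two-chain contraction argument, general target size.**  For a `T`-query algorithm `A` with `T ≥ 2`, a target
size `T₂ ≥ T` and weights `c` on the `T₂`-subsets with `Σ_{U ∋ k} |c_U|² ≤ 1` for all `k`:
`Σ_{|R| = T₂ − T + 1} ‖Γ[ψ](R)‖² ≤ 4` for the final state `ψ`, `Γ = gam c T₂` — the functional ONE BELOW the top
level of the running state (the case `T₂ = 2T − 1` is `sum_norm_sq_gam_second_finalState_le`; `T₂ = 2T − 2` pairs
two second-level vectors, as needed for the Walsh level `2T − 2`). [cite: EscuderoGutierrez2023, §4.2] -/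
theorem sum_norm_sq_gam_second_le (A : QQueryAlg N) (hT : 2 ≤ A.queries) (T₂ : ℕ) (hT₂ : A.queries ≤ T₂)
    (c : Finset (Fin N) → ℂ)
    (hc : ∀ k : Fin N,
      ∑ U ∈ Finset.univ.filter (fun U : Finset (Fin N) => U.card = T₂ ∧ k ∈ U), ‖c U‖ ^ 2 ≤ 1) :
    ∑ R ∈ Finset.univ.filter (fun R : Finset (Fin N) => R.card = T₂ - A.queries + 1),
      ∑ s, ‖gam c T₂ (fun x => A.finalState x) R s‖ ^ 2 ≤ 4 := by
  let step : ((Fin N → Bool) → Fin N × Bool × A.W → ℂ) → Fin A.queries →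
      ((Fin N → Bool) → Fin N × Bool × A.W → ℂ) :=
    fun Ψ j => fun b => (A.unitaries j.succ).1 *ᵥ (queryOracle b *ᵥ Ψ b)
  let u : Fin N × Bool × A.W → ℂ := (A.unitaries 0).1 *ᵥ Pi.single A.start 1
  let init : (Fin N → Bool) → Fin N × Bool × A.W → ℂ := fun _ => u
  have h1T : 1 < A.queries := hT
  let u1 : Fin N × Bool × A.W → ℂ := (A.unitaries (Fin.succ ⟨0, by omega⟩)).1 *ᵥ blockPlus u
  -- the auxiliary chain (stay at the first query, then the true steps): `auxm m` = its state at time `m + 1`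
  let auxm : ℕ → ((Fin N → Bool) → Fin N × Bool × A.W → ℂ) := fun m =>
    Nat.rec (motive := fun _ => (Fin N → Bool) → Fin N × Bool × A.W → ℂ) (fun _ => u1)
      (fun m Φ => if h : m + 1 < A.queries then step Φ ⟨m + 1, h⟩ else Φ) m
  have auxm_zero : auxm 0 = fun _ => u1 := rfl
  have auxm_succ : ∀ (m : ℕ) (h : m + 1 < A.queries), auxm (m + 1) = step (auxm m) ⟨m + 1, h⟩ := by
    intro m h
    show (if h : m + 1 < A.queries then step (auxm m) ⟨m + 1, h⟩ else auxm m) = _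
    rw [dif_pos h]
  have hu : ∑ s, ‖u s‖ ^ 2 = 1 := by
    simp only [u]
    rw [sum_norm_sq_mulVec_of_mem_unitaryGroup (A.unitaries 0).2, Finset.sum_eq_single A.start]
    · simp
    · intro s _ hs; simp [hs]
    · simp
  have hu1 : ∑ s, ‖u1 s‖ ^ 2 ≤ 1 := by
    simp only [u1]
    rw [sum_norm_sq_mulVec_of_mem_unitaryGroup (A.unitaries _).2, ← hu,
      ← sum_norm_sq_blockDiff_add_blockPlus u]
    have : 0 ≤ ∑ k, ∑ s, ‖blockDiff k u s‖ ^ 2 :=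
      Finset.sum_nonneg fun k _ => Finset.sum_nonneg fun s _ => by positivity
    linarith
  -- the invariant
  let P : ℕ → ((Fin N → Bool) → Fin N × Bool × A.W → ℂ) → Prop := fun j Ψ =>
    (∀ S : Finset (Fin N), j < S.card → vfc Ψ S = 0) ∧ (j = 0 → Ψ = init) ∧
    (1 ≤ j →
      (∀ S : Finset (Fin N), j - 1 < S.card → vfc (auxm (j - 1)) S = 0) ∧
      (∑ R ∈ Finset.univ.filter (fun R : Finset (Fin N) => R.card = T₂ - j),
          ∑ s, ‖gam c T₂ Ψ R s‖ ^ 2) +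
        (∑ R ∈ Finset.univ.filter (fun R : Finset (Fin N) => R.card = T₂ - j + 1),
          ∑ s, ‖(gam c T₂ Ψ R - gam c T₂ (auxm (j - 1)) R) s‖ ^ 2) ≤ 1 ∧
      (∑ R ∈ Finset.univ.filter (fun R : Finset (Fin N) => R.card = T₂ - j + 1),
          ∑ k ∈ R, ∑ s, ‖blockDiff k (gam c T₂ (auxm (j - 1)) R) s‖ ^ 2 ≤ 1) ∧
      (2 ≤ j → ∑ R ∈ Finset.univ.filter (fun R : Finset (Fin N) => R.card = T₂ - j + 1),
          ∑ s, ‖gam c T₂ (auxm (j - 1)) R s‖ ^ 2 ≤ 1))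
  have h0 : P 0 init := ⟨level_mulVec (level_const _) _, fun _ => rfl, fun h => absurd h (by norm_num)⟩
  have hstep : ∀ (j : Fin A.queries) (Ψ : (Fin N → Bool) → Fin N × Bool × A.W → ℂ),
      P j Ψ → P (j + 1) (step Ψ j) := by
    rintro ⟨j, hjlt⟩ Ψ ⟨hlev, hinit, hrest⟩
    refine ⟨level_mulVec (level_oracle hlev) _, fun h => absurd h (by simp), fun _ => ?_⟩
    simp only [Nat.add_sub_cancel]
    rcases Nat.eq_zero_or_pos j with hj0 | hjpos
    · -- base: time 0 → 1
      subst hj0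
      have hΨ : Ψ = init := hinit rfl
      subst hΨ
      refine ⟨?_, ?_, ?_, fun h => absurd h (by norm_num)⟩
      · intro S hS
        rw [auxm_zero]
        exact level_const _ S (by omega)
      · rw [auxm_zero]
        have hTop : ∑ R ∈ Finset.univ.filter (fun R : Finset (Fin N) => R.card = T₂ - (0 + 1)),
            ∑ s, ‖gam c T₂ (step init ⟨0, hjlt⟩) R s‖ ^ 2 ≤ 1 := by
          change ∑ R ∈ Finset.univ.filter (fun R : Finset (Fin N) => R.card = T₂ - (0 + 1)),
            ∑ s, ‖gam c T₂ (fun b => (A.unitaries (Fin.succ ⟨0, hjlt⟩)).1 *ᵥ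
              (queryOracle b *ᵥ init b)) R s‖ ^ 2 ≤ 1
          rw [sum_norm_sq_gam_step c (level_const u) (A.unitaries _).2 (by omega : T₂ - (0 + 1) + (0 + 1) = T₂),
            show T₂ - (0 + 1) + 1 = T₂ from by omega]
          exact base_bound c hc u hu
        have hD : ∑ R ∈ Finset.univ.filter (fun R : Finset (Fin N) => R.card = T₂ - (0 + 1) + 1),
            ∑ s, ‖(gam c T₂ (step init ⟨0, hjlt⟩) R - gam c T₂ (fun _ => u1) R) s‖ ^ 2 = 0 := by
          refine Finset.sum_eq_zero fun R hR => ?_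
          rw [Finset.mem_filter] at hR
          have hRc : R.card = T₂ := by omega
          have e1 : gam c T₂ (step init ⟨0, hjlt⟩) R = c R • u1 := by
            rw [gam_top c _ hRc]
            change c R • vfc (fun b => (A.unitaries (Fin.succ ⟨0, hjlt⟩)).1 *ᵥ
              (queryOracle b *ᵥ (fun _ : Fin N → Bool => u) b)) ∅ = c R • u1
            rw [vfc_step_const_empty]
          rw [e1, gam_top c _ hRc, vfc_const_empty, sub_self]
          simp
        rw [hD, add_zero]
        exact hTop
      · rw [auxm_zero, show T₂ - (0 + 1) + 1 = T₂ from by omega]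
        exact base_bound_le c hc u1 hu1
    · -- step: time j → j + 1 with j ≥ 1
      obtain ⟨hlev1, hpot, hI1, hOne⟩ := hrest hjpos
      have hauxj : auxm j = step (auxm (j - 1)) ⟨j, hjlt⟩ := by
        obtain ⟨m, rfl⟩ : ∃ m, j = m + 1 := ⟨j - 1, by omega⟩
        rw [Nat.add_sub_cancel]
        exact auxm_succ m hjlt
      have hlev1' : ∀ S : Finset (Fin N), j < S.card → vfc (auxm j) S = 0 := by
        intro S hS
        rw [hauxj]
        exact level_mulVec (level_oracle hlev1) _ S (by show j - 1 + 1 < S.card; omega)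
      -- `One_{j+1} = I¹_j ≤ 1`
      have hOne' : ∑ R ∈ Finset.univ.filter (fun R : Finset (Fin N) => R.card = T₂ - (j + 1) + 1),
          ∑ s, ‖gam c T₂ (auxm j) R s‖ ^ 2 ≤ 1 := by
        rw [hauxj]
        change ∑ R ∈ Finset.univ.filter (fun R : Finset (Fin N) => R.card = T₂ - (j + 1) + 1),
          ∑ s, ‖gam c T₂ (fun b => (A.unitaries (Fin.succ ⟨j, hjlt⟩)).1 *ᵥ
            (queryOracle b *ᵥ auxm (j - 1) b)) R s‖ ^ 2 ≤ 1
        rw [sum_norm_sq_gam_step c hlev1 (A.unitaries _).2 (by omega : T₂ - (j + 1) + 1 + (j - 1 + 1) = T₂),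
          show T₂ - (j + 1) + 1 + 1 = T₂ - j + 1 from by omega]
        exact hI1
      refine ⟨hlev1', ?_, ?_, fun _ => hOne'⟩
      · -- the potential
        rw [hauxj]
        have hp := potential_step c hjpos (by omega : j + 1 ≤ T₂) hlev hlev1 (A.unitaries (Fin.succ ⟨j, hjlt⟩)).2
          (Ψ := Ψ) (Φ := auxm (j - 1)) (T₂ := T₂)
        rw [show T₂ - (j + 1) + 1 = T₂ - j from by omega]
        exact hp.trans hpot
      · calc ∑ R ∈ Finset.univ.filter (fun R : Finset (Fin N) => R.card = T₂ - (j + 1) + 1),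
              ∑ k ∈ R, ∑ s, ‖blockDiff k (gam c T₂ (auxm j) R) s‖ ^ 2
            ≤ ∑ R ∈ Finset.univ.filter (fun R : Finset (Fin N) => R.card = T₂ - (j + 1) + 1),
              ∑ s, ‖gam c T₂ (auxm j) R s‖ ^ 2 :=
              Finset.sum_le_sum fun R _ =>
                (Finset.sum_le_sum_of_subset_of_nonneg (Finset.subset_univ R) fun k _ _ =>
                  Finset.sum_nonneg fun s _ => by positivity).trans (sum_norm_sq_blockDiff_le _)
          _ ≤ 1 := hOne'
  have key : P A.queries (Fin.foldl A.queries step init) := foldl_invariant A.queries step init P h0 hstep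
  have e : (fun x => A.finalState x) = Fin.foldl A.queries step init :=
    foldl_pi A.queries (fun (x : Fin N → Bool) (ψ : Fin N × Bool × A.W → ℂ) (j : Fin A.queries) =>
      (A.unitaries j.succ).1 *ᵥ (queryOracle x *ᵥ ψ)) (fun _ => (A.unitaries 0).1 *ᵥ Pi.single A.start 1)
  rw [e]
  obtain ⟨-, hpot, -, hOne⟩ := key.2.2 (by omega)
  have hOneT := hOne hT
  have hD : ∑ R ∈ Finset.univ.filter (fun R : Finset (Fin N) => R.card = T₂ - A.queries + 1),
      ∑ s, ‖(gam c T₂ (Fin.foldl A.queries step init) R - gam c T₂ (auxm (A.queries - 1)) R) s‖ ^ 2 ≤ 1 := by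
    have h0le : 0 ≤ ∑ R ∈ Finset.univ.filter (fun R : Finset (Fin N) => R.card = T₂ - A.queries),
        ∑ s, ‖gam c T₂ (Fin.foldl A.queries step init) R s‖ ^ 2 :=
      Finset.sum_nonneg fun R _ => Finset.sum_nonneg fun s _ => by positivity
    linarith
  calc ∑ R ∈ Finset.univ.filter (fun R : Finset (Fin N) => R.card = T₂ - A.queries + 1),
        ∑ s, ‖gam c T₂ (Fin.foldl A.queries step init) R s‖ ^ 2
      ≤ ∑ R ∈ Finset.univ.filter (fun R : Finset (Fin N) => R.card = T₂ - A.queries + 1),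
          (2 * ∑ s, ‖(gam c T₂ (Fin.foldl A.queries step init) R - gam c T₂ (auxm (A.queries - 1)) R) s‖ ^ 2 +
            2 * ∑ s, ‖gam c T₂ (auxm (A.queries - 1)) R s‖ ^ 2) :=
        Finset.sum_le_sum fun R _ => sum_norm_sq_le_two_mul _ _
    _ ≤ 4 := by
        rw [Finset.sum_add_distrib, ← Finset.mul_sum, ← Finset.mul_sum]
        linarith

/-- **Pairing bound one below the top, general size**: `|Σ_{|R| = T₂−T+1} ⟨Π v_R, Γ(R)⟩| ≤ 2`. [cite: EscuderoGutierrez2023, §4.2] -/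
theorem norm_pairing_second_le_two' (A : QQueryAlg N) (hT : 2 ≤ A.queries) (T₂ : ℕ) (hT₂ : A.queries ≤ T₂)
    (c : Finset (Fin N) → ℂ)
    (hc : ∀ k : Fin N,
      ∑ U ∈ Finset.univ.filter (fun U : Finset (Fin N) => U.card = T₂ ∧ k ∈ U), ‖c U‖ ^ 2 ≤ 1) :
    ‖∑ R ∈ Finset.univ.filter (fun R : Finset (Fin N) => R.card = T₂ - A.queries + 1),
        star (accVfc A R) ⬝ᵥ gam c T₂ (fun x => A.finalState x) R‖ ≤ 2 := by
  set F := Finset.univ.filter (fun R : Finset (Fin N) => R.card = T₂ - A.queries + 1)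
  set a : Finset (Fin N) → ℝ := fun R => ∑ s, ‖accVfc A R s‖ ^ 2
  set b : Finset (Fin N) → ℝ := fun R => ∑ s, ‖gam c T₂ (fun x => A.finalState x) R s‖ ^ 2
  have ha : ∀ R, 0 ≤ a R := fun R => Finset.sum_nonneg fun s _ => by positivity
  have hb : ∀ R, 0 ≤ b R := fun R => Finset.sum_nonneg fun s _ => by positivity
  have hA : ∑ R ∈ F, a R ≤ 1 := sum_norm_sq_accVfc_le' A F
  have hB : ∑ R ∈ F, b R ≤ 4 := sum_norm_sq_gam_second_le A hT T₂ hT₂ c hc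
  calc ‖∑ R ∈ F, star (accVfc A R) ⬝ᵥ gam c T₂ (fun x => A.finalState x) R‖
      ≤ ∑ R ∈ F, ‖star (accVfc A R) ⬝ᵥ gam c T₂ (fun x => A.finalState x) R‖ := norm_sum_le _ _
    _ ≤ ∑ R ∈ F, Real.sqrt (a R) * Real.sqrt (b R) :=
        Finset.sum_le_sum fun R _ => norm_star_dotProduct_le _ _
    _ ≤ Real.sqrt (∑ R ∈ F, a R) * Real.sqrt (∑ R ∈ F, b R) := Real.sum_sqrt_mul_sqrt_le F ha hb
    _ ≤ Real.sqrt 1 * Real.sqrt 4 := by gcongr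
    _ = 2 := by
        rw [Real.sqrt_one, one_mul, show (4 : ℝ) = 2 ^ 2 by norm_num, Real.sqrt_sq (by norm_num)]

end Summit.QuantumAdvantage.QuantumAdvantage.Theorems.SosSandwich.QueryTopLevel

end
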